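import Summits.HodgeConjecture.HodgeConjecture.Theses.NikulinTwinTransport
import Summits.HodgeConjecture.HodgeConjecture.Theorems.NikulinTwinTransportTwinSimilitudeAlgebraic
import Summits.HodgeConjecture.HodgeConjecture.Theorems.NikulinTwinTransportTwinSimilitudeAlgebraicMarkings
import Summits.HodgeConjecture.HodgeConjecture.Theorems.NikulinTwinTransportSquareTranscendental
import Literature.AlgebraicGeometry.Surfaces.K3Marking
import Literature.AlgebraicGeometry.Surfaces.K3HodgeTypesHolds
import Literature.AlgebraicGeometry.HodgeTheory.HodgeIndexSurface
import Literature.AlgebraicGeometry.HodgeTheory.ComplexGysinCorrespondence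
import HarnessLib

/-!
# Route NikulinTwinTransport · crux `TwinSimilitudeAlgebraic` (stmt-HodgeConjecture-13674) —
# stub `stub_anchorForward` of line `hyperkaehler-nikulin-anchors` (reshape r6)

**The forward map of an out-anchor is a rational, type-preserving `2`-similitude.**
Let `S`, `Sg` be projective K3 surfaces with integral generators `p`, `pg` of `H⁴`, and let
`Ψ : H²(S(ℂ); ℂ) ≃ H²(Sg(ℂ); ℂ)` be a `ℂ`-linear equivalence whose INVERSE is rational,
type-preserving and HALVES the cup form (`(u.v) = 2b·pg ⟹ (Ψ⁻¹u.Ψ⁻¹v) = b·p`). Then `Ψ` itself is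
rational, type-preserving and DOUBLES the cup form (`(x.y) = c·p ⟹ (Ψx.Ψy) = 2c·pg`).

Proof (`stub_anchorForward`, the mirror image of the landed `stub_outAnchorOfSimilitude`): mark
both surfaces (`Huybrechts_K3_marking_exists`: `η : H²(S) ≅ Λ_ℂ`, cup product `= (η·.η·) p₀`,
`p₀ = n p`; `η'`, `p₀' = n' pg` for `Sg`), so that every cup product on `S` is a multiple of `p`
and every cup product on `Sg` a multiple of `pg` (`p, pg ≠ 0`, `generator_ne_zero`).
(i) doubling: `(Ψx.Ψ(2y)) = 2d·pg` for the scalar `d` read off through `η'`, so halving gives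
`(x.2y) = d·p`, i.e. `d = 2c` whenever `(x.y) = c·p`; in particular `(x.y) = 0 ⟹ (Ψx.Ψy) = 0`.
(ii) rational: through the markings `Ψ⁻¹` is the complexification of an injective, hence
bijective, `ℚ`-linear endomorphism `τ` of `Λ_ℚ` (`markingConj_intCast`,
`exists_ratEnd_of_forall_intCast`, `isRationalClass_iff_of_marking`); a rational `x` has
`ηx = τu`, so `Ψx = η'⁻¹u` is rational. (iii) types: with `σ = η⁻¹x₀`, `σ' = η'⁻¹x₀'` the
`(2,0)`-classes, `Ψ⁻¹σ' = t₁σ`, `Ψ⁻¹σ̄' = t₂σ̄` with `t₁, t₂ ≠ 0` (types `(2,0)`, `(0,2)` are lines,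
`Huybrechts_K3_hodgeTypes_H2_holds`; `Ψ⁻¹` is injective), so `Ψσ = t₁⁻¹σ'`, `Ψσ̄ = t₂⁻¹σ̄'`, and
`Ψ` preserves `H^{1,1} = ⟨σ, σ̄⟩^⊥` by (i); the types `(i, j)` with `i + j ≠ 2` carry only `0`
(`isOfHodgeType_eq_zero_of_add_ne`).

Hypotheses (all in the registered signature): `Huybrechts_K3_marking_exists`. Prover seat
prover-line-stmt-HodgeConjecture-13674-c2-0.

## References

* [Huybrechts2016K3] D. Huybrechts, Lectures on K3 Surfaces, CUP 2016, Ch. 1 Prop. 3.5, Ch. 3 §2,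
  Ch. 6 Prop. 1.2.
* [Buskin2019] N. Buskin, J. reine angew. Math. 755 (2019), §6.2 (markings, proof of Thm. 1.1).
* [Varesco2023] M. Varesco, Math. Z. 305 (2023), §2, Rem. 2.2.
-/

noncomputable section

set_option linter.dupNamespace false

open CategoryTheory MonoidalCategory
open scoped Manifold Matrix
open Literature.AlgebraicGeometry.Motives Literature.AlgebraicGeometry.HodgeTheory
open Literature.AlgebraicGeometry.Surfaces Literature.Geometry.Kaehler
open Literature.AlgebraicTopology.SingularHomology
open Summit.HodgeConjecture.HodgeConjecture.Theses.NikulinTwinTransport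

namespace Summit.HodgeConjecture.HodgeConjecture.Theorems.NikulinTwinTransport

/-! ## Local notation — VERBATIM that of the registered skeleton
`Cruxes/TwinSimilitudeAlgebraic/Lines/hyperkaehler_nikulin_anchors.lean` -/

/-- `Gen[S, p]`: `p` is an integral generator of `H⁴(S(ℂ); ℂ)` (the generator clause of X). Local notation
only. -/
local notation3 (prettyPrint := false) "Gen[" S ", " p "]" =>
  (IsIntegralClass p ∧ ∀ q : complexBetti S (2 * 2), IsIntegralClass q → ∃ n : ℤ, q = n • p)

/-! ## The stub -/

/-- **The forward map of an out-anchor is a rational, type-preserving `2`-similitude**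
(registered stub `stub_anchorForward` of line `hyperkaehler-nikulin-anchors`, reshape r6): for
projective K3 surfaces `S, Sg` with integral generators `p, pg` of `H⁴` and a `ℂ`-linear
equivalence `Ψ : H²(S) ≃ H²(Sg)` whose inverse is rational, type-preserving and halves the cup
form, `Ψ` is rational (through markings `Ψ⁻¹` is the complexification of a bijective `ℚ`-linear
endomorphism of `Λ_ℚ`), type-preserving (`Ψ⁻¹` carries the period lines `H^{2,0}`, `H^{0,2}` of
`Sg` onto those of `S` by non-zero scalars, and `H^{1,1} = ⟨σ, σ̄⟩^⊥` is preserved since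
`(x.y) = 0 ⟹ (Ψx.Ψy) = 0`; classes of type `(i, j)`, `i + j ≠ 2`, vanish) and doubles
(`(x.y) = c·p`, `(Ψx.Ψ(2y)) = 2d·pg` through the marking of `Sg`, and halving gives `d = 2c`).
Mirror image of `stub_outAnchorOfSimilitude`.
[cite: Huybrechts2016K3, Ch. 1 Prop. 3.5 and Ch. 6 Prop. 1.2] [cite: Buskin2019, §6.2, proof of Thm. 1.1] -/
theorem stub_anchorForward :
    Huybrechts_K3_marking_exists →
      ∀ (S Sg : SchemeOver ℂ) (hS : IsK3Surface S) (hSg : IsK3Surface Sg)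
        (p : complexBetti S (2 * 2)) (pg : complexBetti Sg (2 * 2)), Gen[S, p] → Gen[Sg, pg] →
        ∀ (Ψ : complexBetti S (2 * 1) ≃ₗ[ℂ] complexBetti Sg (2 * 1)),
          (∀ y, IsRationalClass y → IsRationalClass (Ψ.symm y)) →
          (∀ (i j : ℕ) y, IsOfHodgeType 2 Sg (2 * 1) i j y →
            IsOfHodgeType 2 S (2 * 1) i j (Ψ.symm y)) →
          (∀ (u v : complexBetti Sg (2 * 1)) (b : ℂ),
            cupProduct (rfl : 2 * 1 + 2 * 1 = 2 * 2) u v = ((2 : ℂ) * b) • pg →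
              cupProduct (rfl : 2 * 1 + 2 * 1 = 2 * 2) (Ψ.symm u) (Ψ.symm v) = b • p) →
          (∀ x, IsRationalClass x → IsRationalClass (Ψ x)) ∧
          (∀ (i j : ℕ) x, IsOfHodgeType 2 S (2 * 1) i j x →
            IsOfHodgeType 2 Sg (2 * 1) i j (Ψ x)) ∧
          (∀ (x y : complexBetti S (2 * 1)) (c : ℂ),
            cupProduct (rfl : 2 * 1 + 2 * 1 = 2 * 2) x y = c • p →
              cupProduct (rfl : 2 * 1 + 2 * 1 = 2 * 2) (Ψ x) (Ψ y) = ((2 : ℂ) * c) • pg) := by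
  intro hmark S Sg hS hSg p pg hp hpg Ψ hr ht hs
  -- markings of `S` and of `Sg`
  obtain ⟨η, p₀, x₀, -, ⟨hp₀int, -, hηint, hηcup, h20, -⟩, ⟨-, hxpos, -⟩⟩ := hmark S hS
  obtain ⟨η', p₀', x₀', -, ⟨hp₀'int, -, hη'int, hη'cup, h20', -⟩, ⟨-, hx'pos, -⟩⟩ := hmark Sg hSg
  -- `p₀ = n p`, `p₀' = n' pg`, `p, pg ≠ 0`; every cup product on `S` (`Sg`) is a multiple of `p` (`pg`)
  obtain ⟨n, hn⟩ := hp.2 p₀ hp₀int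
  obtain ⟨n', hn'⟩ := hpg.2 p₀' hp₀'int
  rw [← Int.cast_smul_eq_zsmul ℂ] at hn hn'
  have hp0 : p ≠ 0 := generator_ne_zero hS hp.2
  have hcp : ∀ x y : complexBetti S (2 * 1),
      cupProduct (rfl : 2 * 1 + 2 * 1 = 2 * 2) x y = (k3Form (η x) (η y) * (n : ℂ)) • p := by
    intro x y
    rw [hηcup, hn, smul_smul]
  have hcpg : ∀ u v : complexBetti Sg (2 * 1),
      cupProduct (rfl : 2 * 1 + 2 * 1 = 2 * 2) u v = (k3Form (η' u) (η' v) * (n' : ℂ)) • pg := by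
    intro u v
    rw [hη'cup, hn', smul_smul]
  -- (i) doubling: `(Ψx.Ψ(2y)) = 2d pg`, halving gives `(x.2y) = d p`, so `d = 2 (ηx.ηy) n`
  have hΨ2 : ∀ x y : complexBetti S (2 * 1),
      cupProduct (rfl : 2 * 1 + 2 * 1 = 2 * 2) (Ψ x) (Ψ y) =
        ((2 : ℂ) * (k3Form (η x) (η y) * (n : ℂ))) • pg := by
    intro x y
    have h1 : cupProduct (rfl : 2 * 1 + 2 * 1 = 2 * 2) (Ψ x) (Ψ ((2 : ℂ) • y)) =
        ((2 : ℂ) * (k3Form (η' (Ψ x)) (η' (Ψ y)) * (n' : ℂ))) • pg := by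
      rw [map_smul, map_smul, hcpg, smul_smul]
    have h2 := hs _ _ _ h1
    rw [LinearEquiv.symm_apply_apply, LinearEquiv.symm_apply_apply, map_smul, hcp, smul_smul] at h2
    rw [hcpg, ← smul_left_injective ℂ hp0 h2]
  have hdouble : ∀ (x y : complexBetti S (2 * 1)) (c : ℂ),
      cupProduct (rfl : 2 * 1 + 2 * 1 = 2 * 2) x y = c • p →
        cupProduct (rfl : 2 * 1 + 2 * 1 = 2 * 2) (Ψ x) (Ψ y) = ((2 : ℂ) * c) • pg := by
    intro x y c hc
    rw [hcp] at hc
    rw [hΨ2, smul_left_injective ℂ hp0 hc]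
  have hzero : ∀ x y : complexBetti S (2 * 1),
      cupProduct (rfl : 2 * 1 + 2 * 1 = 2 * 2) x y = 0 →
        cupProduct (rfl : 2 * 1 + 2 * 1 = 2 * 2) (Ψ x) (Ψ y) = 0 := by
    intro x y h
    rw [hdouble x y 0 (by rw [h, zero_smul]), mul_zero, zero_smul]
  -- (ii) `η ∘ Ψ⁻¹ ∘ η'⁻¹` is the complexification of a bijective `ℚ`-linear `τ`
  obtain ⟨τ, hτ⟩ :=
    exists_ratEnd_of_forall_intCast _
      (markingConj_intCast hS η hηint η' hη'int Ψ.symm.toLinearMap fun y hy => hr y hy)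
  have hτ' : ∀ u : K3Index → ℚ,
      η (Ψ.symm (η'.symm fun i => (u i : ℂ))) = fun i => (τ u i : ℂ) := fun u => by
    simpa only [LinearMap.coe_comp, LinearEquiv.coe_coe, Function.comp_apply] using hτ u
  have hτinj : Function.Injective τ := by
    refine (injective_iff_map_eq_zero _).2 fun u hu => ?_
    have h := hτ' u
    rw [hu] at h
    have h0 : η (Ψ.symm (η'.symm fun i => (u i : ℂ))) = 0 := by
      rw [h]
      funext i
      simp only [Pi.zero_apply, Rat.cast_zero]
    rw [LinearEquiv.map_eq_zero_iff, LinearEquiv.map_eq_zero_iff, LinearEquiv.map_eq_zero_iff] at h0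
    funext i
    have hi := congrFun h0 i
    simpa using hi
  have hτsurj : Function.Surjective τ := LinearMap.injective_iff_surjective.1 hτinj
  -- (iii) the `(2,0)`-classes `σ = η⁻¹ x₀`, `σ' = η'⁻¹ x₀'` and the Hodge types of `S`, `Sg`
  have hσ0 : η.symm x₀ ≠ 0 := fun h0 =>
    ne_zero_of_star_self_re_pos hxpos (by simpa using congrArg η h0)
  have hσ'0 : η'.symm x₀' ≠ 0 := fun h0 =>
    ne_zero_of_star_self_re_pos hx'pos (by simpa using congrArg η' h0)
  have hstar'0 : η'.symm (star x₀') ≠ 0 := fun h0 => by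
    apply hσ'0
    have : star x₀' = 0 := by simpa using congrArg η' h0
    rw [show x₀' = star (star x₀') from (star_star x₀').symm, this, star_zero, map_zero]
  obtain ⟨h1, h2, h3⟩ := Huybrechts_K3_hodgeTypes_H2_holds S hS (η.symm x₀) h20 hσ0
  obtain ⟨h1', h2', h3'⟩ := Huybrechts_K3_hodgeTypes_H2_holds Sg hSg (η'.symm x₀') h20' hσ'0
  rw [conjClass_marking_symm η hηint] at h2 h3
  rw [conjClass_marking_symm η' hη'int] at h2' h3'
  -- `Ψ⁻¹ σ' = t₁ σ`, `Ψ⁻¹ σ̄' = t₂ σ̄` with `t₁, t₂ ≠ 0`, hence `Ψ σ = t₁⁻¹ σ'`, `Ψ σ̄ = t₂⁻¹ σ̄'`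
  obtain ⟨t₁, ht₁⟩ := (h1 _).1 (ht 2 0 _ h20')
  obtain ⟨t₂, ht₂⟩ := (h2 _).1 (ht 0 2 _ ((h2' _).2 ⟨1, (one_smul ℂ _).symm⟩))
  have ht₁0 : t₁ ≠ 0 := by
    rintro rfl
    exact hσ'0 ((LinearEquiv.map_eq_zero_iff Ψ.symm).1 (by rw [ht₁, zero_smul]))
  have ht₂0 : t₂ ≠ 0 := by
    rintro rfl
    exact hstar'0 ((LinearEquiv.map_eq_zero_iff Ψ.symm).1 (by rw [ht₂, zero_smul]))
  have hσfwd : Ψ (η.symm x₀) = t₁⁻¹ • η'.symm x₀' := by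
    have h : η.symm x₀ = t₁⁻¹ • Ψ.symm (η'.symm x₀') := by
      rw [ht₁, smul_smul, inv_mul_cancel₀ ht₁0, one_smul]
    rw [h, map_smul, LinearEquiv.apply_symm_apply]
  have hσ'fwd : Ψ (η.symm (star x₀)) = t₂⁻¹ • η'.symm (star x₀') := by
    have h : η.symm (star x₀) = t₂⁻¹ • Ψ.symm (η'.symm (star x₀')) := by
      rw [ht₂, smul_smul, inv_mul_cancel₀ ht₂0, one_smul]
    rw [h, map_smul, LinearEquiv.apply_symm_apply]
  have hσ'eq : η'.symm x₀' = Ψ (t₁ • η.symm x₀) := by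
    rw [← ht₁, LinearEquiv.apply_symm_apply]
  have hstar'eq : η'.symm (star x₀') = Ψ (t₂ • η.symm (star x₀)) := by
    rw [← ht₂, LinearEquiv.apply_symm_apply]
  refine ⟨?_, ?_, hdouble⟩
  · -- `Ψ` is rational
    intro x hx
    obtain ⟨w, hw⟩ := (isRationalClass_iff_of_marking hS η hηint x).1 hx
    obtain ⟨u, rfl⟩ := hτsurj w
    have hx' : Ψ.symm (η'.symm fun i => (u i : ℂ)) = x := by
      apply η.injective
      rw [hw, hτ' u]
    have : Ψ x = η'.symm fun i => (u i : ℂ) := by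
      rw [← hx', LinearEquiv.apply_symm_apply]
    rw [this]
    exact (isRationalClass_iff_of_marking hSg η' hη'int _).2
      ⟨u, by rw [LinearEquiv.apply_symm_apply]⟩
  · -- `Ψ` preserves the Hodge types
    intro i j x hx
    by_cases hij : i + j = 2 * 1
    · obtain ⟨rfl, rfl⟩ | ⟨rfl, rfl⟩ | ⟨rfl, rfl⟩ :
          (i = 2 ∧ j = 0) ∨ (i = 0 ∧ j = 2) ∨ (i = 1 ∧ j = 1) := by omega
      · obtain ⟨t, rfl⟩ := (h1 x).1 hx
        exact (h1' _).2 ⟨t * t₁⁻¹, by rw [map_smul, hσfwd, smul_smul]⟩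
      · obtain ⟨t, rfl⟩ := (h2 x).1 hx
        exact (h2' _).2 ⟨t * t₂⁻¹, by rw [map_smul, hσ'fwd, smul_smul]⟩
      · obtain ⟨hx1, hx2⟩ := (h3 x).1 hx
        refine (h3' _).2 ⟨?_, ?_⟩
        · rw [hσ'eq]
          refine hzero _ _ ?_
          rw [map_smul, hx1, smul_zero]
        · rw [hstar'eq]
          refine hzero _ _ ?_
          rw [map_smul, hx2, smul_zero]
    · obtain rfl := isOfHodgeType_eq_zero_of_add_ne hx hij
      rw [map_zero]
      obtain ⟨A⟩ := hSg.nonempty_hodgeModel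
      exact IsOfHodgeType.zero A _ _ _

end Summit.HodgeConjecture.HodgeConjecture.Theorems.NikulinTwinTransport

end
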